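import Mathlib.NumberTheory.DiophantineApproximation.Basic
import Literature.Computability.Cryptography.ShorOutcomeProbProofs
import HarnessLib

/-!
# Shor's order-finding analysis (§5): the good outcomes, their probability, and the recovery of `r`

Family `PQC` (trunk `CryptoQuantFine`); fourth companion of
`Literature/Computability/Cryptography/Shor.lean`, towards the named fact
`Literature.Computability.Cryptography.Shor1997_orderFinding_isQSolvable` (`ShorProofs.lean`: order finding is solvable in
bounded-error quantum polynomial time — the quantum core of `FACT ∈ BQP`). This file proves the
*classical* half of Shor's analysis of the order-finding experiment (Shor 1997, §5, pp. 13–15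
of arXiv:quant-ph/9508027v2), i.e. everything between the Born-rule probabilities of the
circuit and the success bound, over the tree's definitions `Shor1997.outcomeProb`,
`Shor1997.symmMod` (`ShorProofs`) and the discharged estimate
`Shor1997_outcomeProb_lower_bound_holds` (`ShorOutcomeProbProofs`, threshold `n ≥ 40`):

* **Shor's expression for `P(c, k)`** (`norm_sq_amplitude_eq_outcomeProb`, eqs. (5.5)–(5.7)):
  the squared norm of the post-transform amplitude `q⁻¹ ∑_{a<q, a≡k (r)} e^{2πi ac/q}` of
  `|c, x^k mod n⟩` *is* `outcomeProb q r k c` (substitution `a = br + k`,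
  `filter_mod_eq_image`; `rc` replaced by `{rc}_q`, `exists_symmMod_eq`).
* **The good outcomes** (`two_mul_abs_round_le`, `round_lt`, `round_strictMono`,
  `two_mul_abs_symmMod_le`): for every `d < r` the outcome `c_d = round(dq/r)` satisfies
  `2|rc_d - dq| ≤ r`, hence `|{rc_d}_q| ≤ r/2` (the hypothesis of the `1/3r²` estimate), and
  `d ↦ c_d` is injective; so (`totient_div_le_sum_outcomeProb`, "Counting the good states")
  the outcomes `(c, x^k)`, `k < r`, with `c` good for some `d` coprime to `r` have total
  probability `≥ r · φ(r) · 1/3r² = φ(r)/3r` for `n ≥ n₀`.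
* **Recovery of `r`** (`exists_convergent_eq`: by Legendre's theorem, Mathlib's
  `Real.exists_rat_eq_convergent`, `d/r` is a continued-fraction convergent of `c/q` when
  `2|rc - dq| ≤ r`, `r < n`, `n² ≤ q`; `candidate`, `candidate_eq`, `candidate_div_eq`: the
  denominator `< n` of the fraction nearest to an estimate `ξ` of `d/r` to within `1/2q` (for
  Shor `ξ = c/q`) — unique by `Shor1997.approximant_unique` — is `r` whenever `d` is coprime to
  `r`; `orderGuess`, `orderGuess_eq_of_mem`, `orderGuess_eq`: among repeated trials, the least
  candidate `r'` with `x^{r'} ≡ 1 (mod n)` is the order as soon as one trial is good, since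
  every such `r'` is a multiple of the order, `orderOf_dvd_of_pow_modEq_one`).

What remains for `Shor1997_orderFinding_isQSolvable` is the quantum half: a poly-time uniform
Clifford+T family preparing `q^{-1/2} ∑_a |a⟩|x^a mod n⟩` (§3, reversible modular
exponentiation), a transform extracting `d/r`, and `orderGuess` on `O(log log n)` parallel
trials. Note on the transform: Shor's `A_q` (§4) with `q = 2^l ≥ 16` is *not* an exact circuit
over the tree's gate set `{H, S, T, CNOT}`, even with clean ancillas (its entries
`e^{2πi/q}/√q` do not lie in `ℤ[1/√2, i]`; Giles–Selinger 2013, Thm. 1), so over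
`IsQSolvable`'s Clifford+T model the printed route needs an approximation theorem
(Solovay–Kitaev); the exact alternative is Kitaev's eigenvalue measurement (Kitaev 1995, §3:
Hadamard tests of the controlled powers `x^{2^j}`, Lemmas 8–10 and Thm. 1), which uses only
`H`, `S` and reversible classical gates and ends in the same continued-fraction recovery, so
that `exists_convergent_eq`, `candidate_eq` and `orderGuess_eq` below serve both routes, while
`norm_sq_amplitude_eq_outcomeProb` … `totient_div_le_sum_outcomeProb` formalise the printed one.

## References

* P. W. Shor, *Polynomial-time algorithms for prime factorization and discrete logarithms on a
  quantum computer*, SIAM J. Comput. 26 (1997) 1484–1509 (= arXiv:quant-ph/9508027v2), §5,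
  pp. 13–15: eqs. (5.5)–(5.7), "the probability of seeing a given state `|c, x^k (mod n)⟩` will
  thus be at least `1/3r²` if `-r/2 ≤ {rc}_q ≤ r/2`", the continued-fraction recovery of `d/r`,
  and "Counting the good states".
* A. Yu. Kitaev, *Quantum measurements and the Abelian Stabilizer Problem*,
  arXiv:quant-ph/9511026 (1995), §3 (Remark 8, Lemmas 8–10, Thm. 1).
* B. Giles, P. Selinger, *Exact synthesis of multiqubit Clifford+T circuits*, Phys. Rev. A 87
  (2013) 032332, Thm. 1.
* G. H. Hardy, E. M. Wright, *An Introduction to the Theory of Numbers*, 6th ed. (OUP 2008),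
  Ch. X, §10.15, Thm. 184 (Legendre: `|ξ - p/q| < 1/2q²` implies `p/q` is a convergent) — Mathlib's
  `Real.exists_rat_eq_convergent`.

## Mathlib / tree

From Mathlib: `Real.exists_rat_eq_convergent`, `Real.convergent`, `Rat.den_div_eq_of_coprime`,
`Nat.totient_eq_card_coprime`, `Nat.totient_lt`, `ZMod.unitOfCoprime`, `orderOf_units`,
`orderOf_le_card_univ`, `ZMod.card_units_eq_totient`, `orderOf_dvd_of_pow_eq_one`,
`ZMod.natCast_eq_natCast_iff`, `Complex.exp_int_mul_two_pi_mul_I`,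
`Complex.norm_exp_ofReal_mul_I`, `Nat.find`. From the tree: `Shor1997.outcomeProb`,
`Shor1997.symmMod`, `Shor1997.approximant_unique` (`ShorProofs`),
`Shor1997_outcomeProb_lower_bound_holds` (`ShorOutcomeProbProofs`).

## Design choices

* Goodness of an outcome is expressed by the integer inequality `2|rc - dq| ≤ r` (no rational
  or real rounding in statements); `abs_div_sub_div_le` converts it to Shor's
  `|c/q - d/r| ≤ 1/2q` where the real-analytic lemmas need it.
* `candidate` and `orderGuess` are specified by `Nat.find` (least witness), not by an
  implementation of the continued fraction algorithm: by `approximant_unique` and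
  `exists_convergent_eq` the least candidate denominator is the denominator of the last
  convergent of `c/q` below `n` when that convergent is within `1/2q`, which is what the
  polynomial-time procedure computes; the circuit-level proof will supply the implementation.
  `candidate` takes a real estimate `ξ` (not only `c/q`), so that the same recovery serves any
  procedure estimating `d/r` to within `1/2q`, `q ≥ n²` (e.g. eigenvalue estimation).
-/

noncomputable section

namespace Literature.Computability.Cryptography

open Nat Finset

namespace Shor1997

/-! ### The nearest numerator: for every `d` an outcome `c` with `|rc - dq| ≤ r/2` -/

/-- Shor's good outcome attached to the fraction `d/r`: `c_d = round(dq/r) = ⌊(2dq + r)/2r⌋`.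
Written inline below as `(2 * d * q + r) / (2 * r)`; this lemma is its defining estimate
`2|r c_d - d q| ≤ r`. [Shor 1997, §5, "Each of these fractions `d/r` is close to one fraction
`c/q` with `|c/q - d/r| ≤ 1/2q`"] [cite: Shor1997, §5 (counting the good states)] -/
theorem two_mul_abs_round_le {r : ℕ} (hr : 0 < r) (d q : ℕ) :
    2 * |(r : ℤ) * ((2 * d * q + r) / (2 * r) : ℕ) - d * q| ≤ r := by
  set c := (2 * d * q + r) / (2 * r) with hc
  have h1 : c * (2 * r) ≤ 2 * d * q + r := Nat.div_mul_le_self _ _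
  have h2 : 2 * d * q + r < c * (2 * r) + 2 * r := Nat.lt_div_mul_add (by omega)
  have h1' : (c : ℤ) * (2 * r) ≤ 2 * d * q + r := by exact_mod_cast h1
  have h2' : 2 * (d : ℤ) * q + r < c * (2 * r) + 2 * r := by exact_mod_cast h2
  rcases le_or_gt 0 ((r : ℤ) * c - d * q) with h | h
  · rw [abs_of_nonneg h]; nlinarith
  · rw [abs_of_neg h]; nlinarith

/-- The good outcomes are outcomes: `c_d < q` for `d < r` (when `r < 2q`). [Shor 1997, §5]
[cite: Shor1997, §5 (counting the good states)] -/
theorem round_lt {r d q : ℕ} (hd : d < r) (hrq : r < 2 * q) : (2 * d * q + r) / (2 * r) < q := by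
  rw [Nat.div_lt_iff_lt_mul (by omega)]
  have : 2 * d * q ≤ 2 * (r - 1) * q := by gcongr; omega
  have h3 : 2 * (r - 1) * q + r < q * (2 * r) := by
    zify [show 1 ≤ r by omega]; nlinarith
  omega

/-- Distinct fractions have distinct good outcomes: `d ↦ c_d` is strictly monotone (when
`r ≤ q`). [Shor 1997, §5] [cite: Shor1997, §5 (counting the good states)] -/
theorem round_strictMono {r q : ℕ} (hr : 0 < r) (hrq : r ≤ q) :
    StrictMono fun d : ℕ => (2 * d * q + r) / (2 * r) := by
  refine strictMono_nat_of_lt_succ fun d => ?_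
  have h : 2 * (d + 1) * q + r = (2 * d * q + r) + 2 * q := by ring
  rw [h]
  have h2 := Nat.add_div_le_add_div (2 * d * q + r) (2 * q) (2 * r)
  have h3 : 1 ≤ 2 * q / (2 * r) := (Nat.le_div_iff_mul_le (by omega)).2 (by omega)
  omega

/-- The symmetric residue of a small representative is the representative: if `a ≡ e (mod q)`
and `-q < 2e ≤ q` then `{a}_q = e`. [Shor 1997, §5 (definition of `{rc}_q`)]
[cite: Shor1997, §5 (definition of {rc}_q)] -/
theorem symmMod_eq_of_modEq {a e : ℤ} {q : ℕ} (hq : 0 < q) (h : a ≡ e [ZMOD q])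
    (hlo : -(q : ℤ) < 2 * e) (hhi : 2 * e ≤ q) : symmMod a q = e := by
  unfold symmMod
  have hq' : (0 : ℤ) < q := by exact_mod_cast hq
  have hmod : a % q = e % q := h
  rcases le_or_gt 0 e with he | he
  · have he' : e % q = e := Int.emod_eq_of_lt he (by omega)
    rw [hmod, he', if_neg (by omega)]
  · have he' : e % q = e + q := by
      have h1 : (e + q) % q = e + q := Int.emod_eq_of_lt (by omega) (by omega)
      rw [← h1, Int.add_emod_right]
    rw [hmod, he', if_pos (by omega)]
    ring

/-- For a good outcome, Shor's residue `{rc}_q` is `rc - dq`, hence `|{rc}_q| ≤ r/2` (the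
hypothesis of the `1/3r²` estimate), provided `r < q`. [Shor 1997, §5, "i.e., if there is a
`d` such that `-r/2 ≤ rc - dq ≤ r/2`"] [cite: Shor1997, §5 (bound 1/3r^2 for |{rc}_q| ≤ r/2)] -/
theorem two_mul_abs_symmMod_le {r q c d : ℕ} (hrq : r < q)
    (h : 2 * |(r : ℤ) * c - d * q| ≤ r) : 2 * |symmMod (r * c) q| ≤ r := by
  have hq : 0 < q := by omega
  have hrq' : (r : ℤ) < q := by exact_mod_cast hrq
  have ha := le_abs_self ((r : ℤ) * c - d * q)
  have hb := neg_abs_le ((r : ℤ) * c - d * q)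
  have key : symmMod (r * c) q = (r : ℤ) * c - d * q := by
    have hm : (r : ℤ) * c ≡ (r : ℤ) * c - d * q [ZMOD q] :=
      Int.modEq_iff_dvd.2 ⟨-(d : ℤ), by ring⟩
    have := symmMod_eq_of_modEq hq hm (by omega) (by omega)
    exact_mod_cast this
  rw [key]; exact h

/-! ### Recovery of `d/r` from a good outcome by continued fractions -/

/-- **Legendre's theorem applies to good outcomes** (Shor 1997, §5: "`|c/q - d/r| ≤ 1/2q` …
this fraction can be found in polynomial time by using a continued fraction expansion of
`c/q`"): if `n² ≤ q`, `0 < r < n`, `gcd(d, r) = 1` and `2|rc - dq| ≤ r`, then `d/r` is a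
convergent of the continued fraction expansion of `c/q` (Mathlib's `Real.convergent`, via
`Real.exists_rat_eq_convergent`: `|c/q - d/r| ≤ 1/2q ≤ 1/2n² < 1/2r²`). Together with
`approximant_unique` (at most one fraction with denominator `< n` within `1/2q` of `c/q`) this
is the classical recovery step. [cite: Shor1997, §5 (continued fraction recovery of d/r)] -/
theorem exists_convergent_eq {n q r c d : ℕ} (hq : n ^ 2 ≤ q) (hr : 0 < r) (hrn : r < n)
    (hd : d.Coprime r) (h : 2 * |(r : ℤ) * c - d * q| ≤ r) :
    ∃ m, ((d : ℚ) / r) = Real.convergent ((c : ℝ) / q) m := by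
  apply Real.exists_rat_eq_convergent
  have hden : (((d : ℚ) / r).den : ℝ) = r := by
    have := Rat.den_div_eq_of_coprime (a := d) (b := r) (by exact_mod_cast hr) (by simpa using hd)
    have h' : ((d : ℤ) : ℚ) / ((r : ℤ) : ℚ) = (d : ℚ) / r := by push_cast; rfl
    rw [h'] at this
    exact_mod_cast this
  rw [hden]
  have hR : (0 : ℝ) < r := by exact_mod_cast hr
  have hn : (r : ℝ) + 1 ≤ n := by exact_mod_cast hrn
  have hQ : (n : ℝ) ^ 2 ≤ q := by exact_mod_cast hq
  have hQ0 : (0 : ℝ) < q := lt_of_lt_of_le (by nlinarith) hQ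
  have habs : 2 * |(r : ℝ) * c - d * q| ≤ r := by
    have : ((2 * |(r : ℤ) * c - d * q| : ℤ) : ℝ) ≤ ((r : ℤ) : ℝ) := by exact_mod_cast h
    simpa using this
  have hcast : (((d : ℚ) / r : ℚ) : ℝ) = (d : ℝ) / r := by push_cast; rfl
  rw [hcast]
  have hdiff : (c : ℝ) / q - d / r = ((r : ℝ) * c - d * q) / (r * q) := by
    field_simp
  rw [hdiff, abs_div, abs_of_pos (by positivity : (0 : ℝ) < r * q), div_lt_div_iff₀ (by positivity)
    (by positivity)]
  -- `|rc - dq| · 2r² < r q ⇐ |rc - dq| ≤ r/2` and `r² < n² ≤ q`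
  have h1 : |(r : ℝ) * c - d * q| * (2 * (r : ℝ) ^ 2) ≤ (r : ℝ) / 2 * (2 * (r : ℝ) ^ 2) := by
    gcongr; linarith
  have h2 : (r : ℝ) / 2 * (2 * (r : ℝ) ^ 2) = (r : ℝ) * (r : ℝ) ^ 2 := by ring
  have h3 : (r : ℝ) ^ 2 < q := by nlinarith
  calc |(r : ℝ) * c - d * q| * (2 * (r : ℝ) ^ 2) ≤ (r : ℝ) * (r : ℝ) ^ 2 := h2 ▸ h1
    _ < (r : ℝ) * q := by gcongr
    _ = 1 * ((r : ℝ) * q) := by ring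

/-! ### The number of good states: at least `r φ(r)`, total probability at least `φ(r)/3r` -/

/-- **Shor's count of the good states** (Shor 1997, §5: "There are `φ(r)` possible values of `d`
relatively prime to `r` … Each of these fractions `d/r` is close to one fraction `c/q` with
`|c/q - d/r| ≤ 1/2q`. There are also `r` possible values for `x^k` … Since each of these states
occurs with probability at least `1/3r²`, we obtain `r` with probability at least `φ(r)/3r`").
Explicit form over the tree's `outcomeProb`: for `n ≥ n₀` (the threshold of
`Shor1997_outcomeProb_lower_bound`), `n² ≤ q < 2n²` a power of two and `0 < r < n`, the total
probability of the outcomes `(c, x^k)`, `k < r`, with `c < q` good — some `d < r` coprime to `r`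
has `2|rc - dq| ≤ r` — is at least `φ(r)/3r`. [cite: Shor1997, §5 (counting the good states)] -/
theorem totient_div_le_sum_outcomeProb :
    ∃ n₀ : ℕ, ∀ n q r : ℕ, n₀ ≤ n → n ^ 2 ≤ q → q < 2 * n ^ 2 → (∃ l : ℕ, q = 2 ^ l) →
      0 < r → r < n →
        (Nat.totient r : ℝ) / (3 * r) ≤
          ∑ k ∈ range r, ∑ c ∈ (range q).filter
            (fun c : ℕ => ∃ d < r, d.Coprime r ∧ 2 * |(r : ℤ) * c - d * q| ≤ r),
              outcomeProb q r k c := by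
  classical
  obtain ⟨n₀, hn₀⟩ := Shor1997_outcomeProb_lower_bound_holds
  refine ⟨n₀, fun n q r hn hq hq2 hpow hr hrn => ?_⟩
  have hrq : r < q := by nlinarith
  set good : Finset ℕ := (range q).filter
    (fun c : ℕ => ∃ d < r, d.Coprime r ∧ 2 * |(r : ℤ) * c - d * q| ≤ r) with hgood
  set cOf : ℕ → ℕ := fun d => (2 * d * q + r) / (2 * r) with hcOf
  set D : Finset ℕ := (range r).filter (fun d => r.Coprime d) with hD
  have hDcard : D.card = Nat.totient r := (Nat.totient_eq_card_coprime r).symm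
  -- the good outcomes attached to the `φ(r)` fractions
  have himg : D.image cOf ⊆ good := by
    intro c hc
    rw [Finset.mem_image] at hc
    obtain ⟨d, hd, rfl⟩ := hc
    rw [hD, Finset.mem_filter, Finset.mem_range] at hd
    rw [hgood, Finset.mem_filter, Finset.mem_range]
    exact ⟨round_lt hd.1 (by omega), d, hd.1, hd.2.symm, two_mul_abs_round_le hr d q⟩
  have hinj : Set.InjOn cOf D := (round_strictMono hr hrq.le).injective.injOn
  have hcard : (D.image cOf).card = Nat.totient r := by
    rw [Finset.card_image_of_injOn hinj, hDcard]
  -- each good outcome has probability `≥ 1/3r²`, for every `k < r`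
  have hterm : ∀ k ∈ range r, ∀ c ∈ good, 1 / (3 * (r : ℝ) ^ 2) ≤ outcomeProb q r k c := by
    intro k hk c hc
    rw [hgood, Finset.mem_filter, Finset.mem_range] at hc
    obtain ⟨hcq, d, -, -, hdc⟩ := hc
    exact hn₀ n q r k c hn hq hq2 hpow hr hrn (Finset.mem_range.1 hk) hcq
      (two_mul_abs_symmMod_le hrq hdc)
  have hnonneg : ∀ k c, 0 ≤ outcomeProb q r k c := fun k c => by
    unfold outcomeProb; positivity
  have hR : (0 : ℝ) < r := by exact_mod_cast hr
  calc (Nat.totient r : ℝ) / (3 * r)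
      = ∑ _k ∈ range r, ∑ _c ∈ D.image cOf, 1 / (3 * (r : ℝ) ^ 2) := by
        rw [Finset.sum_const, Finset.sum_const, Finset.card_range, hcard, nsmul_eq_mul,
          nsmul_eq_mul]
        field_simp
    _ ≤ ∑ k ∈ range r, ∑ c ∈ good, outcomeProb q r k c := by
        gcongr with k hk
        calc ∑ _c ∈ D.image cOf, 1 / (3 * (r : ℝ) ^ 2)
            ≤ ∑ c ∈ D.image cOf, outcomeProb q r k c :=
              Finset.sum_le_sum fun c hc => hterm k hk c (himg hc)
          _ ≤ ∑ c ∈ good, outcomeProb q r k c :=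
              Finset.sum_le_sum_of_subset_of_nonneg himg fun c _ _ => hnonneg k c

/-! ### Shor's expression for the probability of observing `|c, x^k mod n⟩` -/

/-- `{a}_q ≡ a (mod q)`: the symmetric residue differs from `a` by a multiple of `q`.
[Shor 1997, §5 (definition of `{rc}_q`)] [cite: Shor1997, §5 (definition of {rc}_q)] -/
theorem exists_symmMod_eq (a : ℤ) (q : ℕ) : ∃ t : ℤ, symmMod a q = a - q * t := by
  unfold symmMod
  split_ifs
  · exact ⟨a / q + 1, by rw [Int.emod_def]; ring⟩
  · exact ⟨a / q, by rw [Int.emod_def]⟩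

/-- The exponents `a < q` with `a ≡ k (mod r)` — for `r` the order of `x`, those with
`x^a ≡ x^k` — are `a = br + k`, `0 ≤ b ≤ ⌊(q-k-1)/r⌋` (Shor 1997, §5, the passage from (5.5) to
(5.6): "we get this sum is … independent of `b`").
[cite: Shor1997, §5 (probability of observing |c, x^k mod n>)] -/
theorem filter_mod_eq_image {q r k : ℕ} (hkr : k < r) (hkq : k < q) :
    (range q).filter (fun a : ℕ => a % r = k) =
      (range ((q - k - 1) / r + 1)).image (fun b => b * r + k) := by
  ext a
  simp only [Finset.mem_filter, Finset.mem_range, Finset.mem_image]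
  constructor
  · rintro ⟨haq, hak⟩
    have h1 : a / r * r + a % r = a := Nat.div_add_mod' a r
    refine ⟨a / r, ?_, by omega⟩
    rw [Nat.lt_succ_iff, Nat.le_div_iff_mul_le (by omega)]
    omega
  · rintro ⟨b, hb, rfl⟩
    rw [Nat.lt_succ_iff, Nat.le_div_iff_mul_le (by omega)] at hb
    refine ⟨by omega, ?_⟩
    rw [add_comm, Nat.add_mul_mod_self_right, Nat.mod_eq_of_lt hkr]

/-- **Shor's expression for `P(c, k)`** (Shor 1997, §5, (5.5)–(5.7), p. 14 of arXiv v2). After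
the transform `A_q` on the first register of `q^{-1/2} ∑_a |a⟩|x^a mod n⟩`, the amplitude of
`|c, x^k mod n⟩` (`0 ≤ k < r`, `r` the order of `x`) is `q⁻¹ ∑_{a < q, a ≡ k (r)} e^{2πi ac/q}`;
its squared norm is the tree's `outcomeProb q r k c = |q⁻¹ ∑_{b=0}^{⌊(q-k-1)/r⌋}
e^{2πi b{rc}_q/q}|²` (substitute `a = br + k`, drop the unit factor `e^{2πi kc/q}`, and replace
`rc` by its residue `{rc}_q ≡ rc (mod q)`). This is the bridge from the Born rule of the
order-finding circuit to the estimate `Shor1997_outcomeProb_lower_bound`.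
[cite: Shor1997, §5 (probability of observing |c, x^k mod n>)] -/
theorem norm_sq_amplitude_eq_outcomeProb {q r k : ℕ} (c : ℕ) (hkr : k < r) (hkq : k < q) :
    ‖(1 / (q : ℂ)) * ∑ a ∈ (range q).filter (fun a : ℕ => a % r = k),
        Complex.exp (2 * Real.pi * Complex.I * (a : ℂ) * (c : ℂ) / (q : ℂ))‖ ^ 2 =
      outcomeProb q r k c := by
  have hr : 0 < r := by omega
  have hq : (q : ℂ) ≠ 0 := by exact_mod_cast (show q ≠ 0 by omega)
  rw [filter_mod_eq_image hkr hkq, Finset.sum_image fun b₁ _ b₂ _ h =>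
    Nat.eq_of_mul_eq_mul_right hr (by omega)]
  unfold outcomeProb
  obtain ⟨t, ht⟩ := exists_symmMod_eq ((r : ℤ) * c) q
  set e : ℂ := Complex.exp (2 * Real.pi * Complex.I * (k : ℂ) * (c : ℂ) / (q : ℂ)) with he
  have hterm : ∀ b : ℕ, Complex.exp (2 * Real.pi * Complex.I * ((b * r + k : ℕ) : ℂ) * c / q) =
      e * Complex.exp (2 * Real.pi * Complex.I * (b : ℂ) * (symmMod (r * c) q : ℂ) / q) := by
    intro b
    rw [he, ← Complex.exp_add, ht]
    have hexp : 2 * Real.pi * Complex.I * ((b * r + k : ℕ) : ℂ) * c / q =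
        2 * Real.pi * Complex.I * (k : ℂ) * (c : ℂ) / (q : ℂ) +
          2 * Real.pi * Complex.I * (b : ℂ) * (((r : ℤ) * c - q * t : ℤ) : ℂ) / q +
          ((b * t : ℤ) : ℂ) * (2 * Real.pi * Complex.I) := by
      push_cast
      field_simp
      ring
    rw [hexp, Complex.exp_add, Complex.exp_int_mul_two_pi_mul_I, mul_one]
  rw [Finset.sum_congr rfl fun b _ => hterm b, ← Finset.mul_sum, mul_left_comm, norm_mul]
  have hunit : ‖e‖ = 1 := by
    rw [he, show 2 * Real.pi * Complex.I * (k : ℂ) * (c : ℂ) / (q : ℂ) =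
      ((2 * Real.pi * k * c / q : ℝ) : ℂ) * Complex.I by push_cast; ring]
    exact Complex.norm_exp_ofReal_mul_I _
  rw [hunit, one_mul]

/-! ### The candidate order read off an outcome, and the selection among repeated trials -/

/-- `IsCandidate n q ξ r'`: `r'` is the denominator, `0 < r' < n`, of a fraction `d'/r'` within
`1/2q` of the real number `ξ` (for Shor, `ξ = c/q` with `c` the observed value). [Shor 1997, §5,
"round `c/q` to the nearest fraction having a denominator smaller than `n`"]
[cite: Shor1997, §5 (continued fraction recovery of d/r)] -/
def IsCandidate (n q : ℕ) (ξ : ℝ) (r' : ℕ) : Prop :=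
  0 < r' ∧ r' < n ∧ ∃ d' : ℤ, |ξ - d' / r'| ≤ 1 / (2 * q)

open Classical in
/-- **Shor's classical recovery step as a function of the measured value**: the least
denominator `0 < r' < n` of a fraction within `1/2q` of `ξ`, and `0` if there is none. When
`q ≥ n²` all such fractions are equal (`approximant_unique`), so this is the denominator of *the*
fraction `d'/r'`, `r' < n`, nearest to `ξ`, in lowest terms — for `ξ = c/q` the one the continued
fraction expansion of `c/q` finds in polynomial time (`exists_convergent_eq`; Shor 1997, §5: "we
can obtain the fraction `d/r` in lowest terms by rounding `c/q` to the nearest fraction having a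
denominator smaller than `n`. This fraction can be found in polynomial time by using a continued
fraction expansion of `c/q`"). Stated for a real `ξ` so that it serves any estimate of `d/r` to
within `1/2q`. [cite: Shor1997, §5 (continued fraction recovery of d/r)] -/
def candidate (n q : ℕ) (ξ : ℝ) : ℕ :=
  if h : ∃ r', IsCandidate n q ξ r' then Nat.find h else 0

/-- **Correctness of the recovery on good estimates** (Shor 1997, §5): if `q ≥ n²`, `0 < r < n`,
`d` is coprime to `r` and `|ξ - d/r| ≤ 1/2q`, then the candidate read off `ξ` is `r` itself
(every candidate fraction equals `d/r` by `approximant_unique`, and `d/r` is in lowest terms).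
[cite: Shor1997, §5 (continued fraction recovery of d/r)] -/
theorem candidate_eq {n q r : ℕ} {d : ℤ} {ξ : ℝ} (hq : n ^ 2 ≤ q) (hr : 0 < r) (hrn : r < n)
    (hd : IsCoprime d r) (h : |ξ - d / r| ≤ 1 / (2 * q)) : candidate n q ξ = r := by
  classical
  have hex : ∃ r', IsCandidate n q ξ r' := ⟨r, hr, hrn, d, h⟩
  rw [candidate, dif_pos hex]
  have hle : Nat.find hex ≤ r := Nat.find_min' hex ⟨hr, hrn, d, h⟩
  obtain ⟨h0, hn', d', hd'⟩ := Nat.find_spec hex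
  have key : d * (Nat.find hex : ℕ) = d' * r := approximant_unique hq hr hrn h0 hn' ξ h hd'
  have hdvd : (r : ℤ) ∣ (Nat.find hex : ℕ) :=
    hd.symm.dvd_of_dvd_mul_left ⟨d', by rw [key, mul_comm]⟩
  exact le_antisymm hle (Nat.le_of_dvd h0 (Int.natCast_dvd_natCast.1 hdvd))

/-- `2|rc - dq| ≤ r` is `|c/q - d/r| ≤ 1/2q`. [Shor 1997, §5]
[cite: Shor1997, §5 (continued fraction recovery of d/r)] -/
theorem abs_div_sub_div_le {q r c d : ℕ} (hr : 0 < r) (hq : 0 < q)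
    (h : 2 * |(r : ℤ) * c - d * q| ≤ r) : |(c : ℝ) / q - d / r| ≤ 1 / (2 * q) := by
  have hR : (0 : ℝ) < r := by exact_mod_cast hr
  have hQ : (0 : ℝ) < q := by exact_mod_cast hq
  have h' : 2 * |(r : ℝ) * c - d * q| ≤ r := by
    have : ((2 * |(r : ℤ) * c - d * q| : ℤ) : ℝ) ≤ ((r : ℤ) : ℝ) := by exact_mod_cast h
    simpa using this
  rw [show (c : ℝ) / q - d / r = ((r : ℝ) * c - d * q) / (r * q) by
      rw [div_sub_div _ _ hQ.ne' hR.ne']; ring,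
    abs_div, abs_of_pos (by positivity : (0 : ℝ) < r * q),
    div_le_div_iff₀ (by positivity) (by positivity)]
  nlinarith [abs_nonneg ((r : ℝ) * c - d * q)]

/-- **Correctness of the recovery on good outcomes**, Shor's integer form: if `q ≥ n²`,
`0 < r < n`, `gcd(d, r) = 1` and `2|rc - dq| ≤ r`, then the candidate read off `c/q` is `r`.
[cite: Shor1997, §5 (continued fraction recovery of d/r)] -/
theorem candidate_div_eq {n q r c d : ℕ} (hq : n ^ 2 ≤ q) (hr : 0 < r) (hrn : r < n)
    (hd : d.Coprime r) (h : 2 * |(r : ℤ) * c - d * q| ≤ r) : candidate n q ((c : ℝ) / q) = r := by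
  have hq0 : 0 < q := by nlinarith
  refine candidate_eq (d := (d : ℤ)) hq hr hrn (Nat.isCoprime_iff_coprime.2 hd) ?_
  rw [Int.cast_natCast]
  exact abs_div_sub_div_le hr hq0 h

/-- **Off good outcomes the recovery is harmless**: every `r'` with `x^{r'} ≡ 1 (mod n)` is a
multiple of the order. [Shor 1997, §5] [folklore] -/
theorem orderOf_dvd_of_pow_modEq_one {x n r' : ℕ} (h : x ^ r' ≡ 1 [MOD n]) :
    orderOf (x : ZMod n) ∣ r' := by
  apply orderOf_dvd_of_pow_eq_one
  rw [← Nat.cast_pow, ← Nat.cast_one, ZMod.natCast_eq_natCast_iff]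
  exact h

open Classical in
/-- **Shor's selection of the order among repeated trials** (Shor 1997, §5, end of the
analysis: repeat the experiment `O(log log r)` times; every candidate `r'` with `x^{r'} ≡ 1` is
a multiple of the order and a good trial contributes the order itself, so the least such
candidate is the order): from the candidates `rs` produced by the trials, the least `r' > 0`
with `x^{r'} ≡ 1 (mod n)` (`0` if none).
[cite: Shor1997, §5 (quantum algorithm for order finding)] -/
def orderGuess (x n : ℕ) (rs : List ℕ) : ℕ :=
  if h : ∃ r', r' ∈ rs ∧ 0 < r' ∧ x ^ r' ≡ 1 [MOD n] then Nat.find h else 0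

/-- The order of a unit modulo `n > 1` is positive and less than `n`. [folklore] -/
theorem orderOf_pos_and_lt {x n : ℕ} (hn : 1 < n) (hx : x.Coprime n) :
    0 < orderOf (x : ZMod n) ∧ orderOf (x : ZMod n) < n := by
  haveI : NeZero n := ⟨by omega⟩
  rw [← ZMod.coe_unitOfCoprime x hx, orderOf_units]
  refine ⟨orderOf_pos _, lt_of_le_of_lt orderOf_le_card_univ ?_⟩
  rw [ZMod.card_units_eq_totient]
  exact Nat.totient_lt n hn

/-- **Correctness of the selection**: if the order of `x` modulo `n` is among the candidates
`rs`, then `orderGuess x n rs` is the order.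
[cite: Shor1997, §5 (quantum algorithm for order finding)] -/
theorem orderGuess_eq_of_mem {x n : ℕ} (hn : 1 < n) (hx : x.Coprime n) {rs : List ℕ}
    (hmem : orderOf (x : ZMod n) ∈ rs) : orderGuess x n rs = orderOf (x : ZMod n) := by
  classical
  set r := orderOf (x : ZMod n) with hr
  obtain ⟨hrpos, -⟩ := orderOf_pos_and_lt hn hx
  rw [← hr] at hrpos
  have hxr : x ^ r ≡ 1 [MOD n] := by
    rw [← ZMod.natCast_eq_natCast_iff, Nat.cast_pow, Nat.cast_one, hr]
    exact pow_orderOf_eq_one _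
  have hex : ∃ r', r' ∈ rs ∧ 0 < r' ∧ x ^ r' ≡ 1 [MOD n] := ⟨r, hmem, hrpos, hxr⟩
  rw [orderGuess, dif_pos hex]
  have hle : Nat.find hex ≤ r := Nat.find_min' hex ⟨hmem, hrpos, hxr⟩
  obtain ⟨-, h0, hmod⟩ := Nat.find_spec hex
  exact le_antisymm hle (Nat.le_of_dvd h0 (hr ▸ orderOf_dvd_of_pow_modEq_one hmod))

/-- **Correctness of Shor's classical post-processing** (Shor 1997, §5): if `1 < n`,
`gcd(x, n) = 1`, `q ≥ n²` and at least one trial outcome `c ∈ cs` is good — `2|rc - dq| ≤ r`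
for some `d` coprime to the order `r` — then the least candidate `r'` with `x^{r'} ≡ 1` among
the candidates read off the outcomes is the order.
[cite: Shor1997, §5 (quantum algorithm for order finding)] -/
theorem orderGuess_eq {x n q : ℕ} (hn : 1 < n) (hx : x.Coprime n) (hq : n ^ 2 ≤ q) {cs : List ℕ}
    (hgood : ∃ c ∈ cs, ∃ d : ℕ, d.Coprime (orderOf (x : ZMod n)) ∧
      2 * |((orderOf (x : ZMod n) : ℕ) : ℤ) * c - d * q| ≤ orderOf (x : ZMod n)) :
    orderGuess x n (cs.map fun c : ℕ => candidate n q ((c : ℝ) / q)) = orderOf (x : ZMod n) := by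
  obtain ⟨hrpos, hrn⟩ := orderOf_pos_and_lt hn hx
  obtain ⟨c, hc, d, hdcop, hcd⟩ := hgood
  have hmem : candidate n q ((c : ℝ) / q) ∈ cs.map (fun c : ℕ => candidate n q ((c : ℝ) / q)) :=
    List.mem_map.2 ⟨c, hc, rfl⟩
  rw [candidate_div_eq hq hrpos hrn hdcop hcd] at hmem
  exact orderGuess_eq_of_mem hn hx hmem

end Shor1997

end Literature.Computability.Cryptography

end
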